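import Summits.ABC.IUTFork.Cor312Steps
import Summits.ABC.IUTFork.Cor312Statement
import Summits.ABC.IUTFork.Thm311LogKummer
import Summits.ABC.IUTFork.Thm311MultiradProofs
import HarnessLib

/-!
# [IUTchIII] Corollary 3.12, proof Step (x), over the real definitions (TEAM A, row A-1)

Record-only file (D-0012) of the abc-iut cell (Cor. 3.12 strategy TEAM A «direct III§3», seat
abc-iut-c312-10 = A2; row **A-1** of `HOME/plan/C312-TEAMS.md`); TAKES NO SIDE. It discharges the proof
node **Step (x)** of [IUTchIII] Cor. 3.12 (kurims text `paper:url-4b091feeb646`, p. 180 l. 43 – p. 181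
l. 32; `Cor312Proof.Step.x` of `Cor312Steps.lean`) as a kernel inference over the frozen definitions:
real readings for its four observations, the kernel lemmas behind each, and `Step.x.Holds` wired to them.

The four observations of (x) (`Cor312Obs.lean`, quotes ibid.) and their REAL readings here, over the
verbatim setting `P : Cor312.Setting S` (c312-7, field names frozen) and c312-1's `Thm311.Column`:

* `Obs.kummerDetachmentInd123` — "The theory of "Kummer-detachment" … allows one to relate the
  Frobenioid-theoretic … structures … at `(0,0)` … to the multiradial representation … at the cost of
  introducing the indeterminacies (Ind1) … (Ind2) … (Ind3)" (p. 180 l. 43–60). Reading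
  `StepX.KummerDetach`: each Kummer image `thetaRegion m` enters the multiradial representation only
  through the (Ind3)-union `thetaRegion3`, which is itself a possible image under the (Ind1)(Ind2)-group.
  As typed this clause is BOOKKEEPING over the frozen `Setting` (proved outright, `kummerDetach_holds`):
  per the team discipline (A.2 row A-5 note) the mathematical weight of the sentence sits in the cited
  Thm 3.11 (ii), (iii) loci, typed by c312-1/L6, and is not inflated here.
* `Obs.logvolInvariantInequality` — "the procession-normalized mono-analytic log-volumes … furnish a
  means of constructing a sort of associated "coarse space" …: the resulting log-volumes `∈ ℝ` are
  invariant with respect to the indeterminacies (Ind1), (Ind2), and have the effect of converting the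
  indeterminacy (Ind3) into an inequality [from above]" (p. 181 l. 5–13). Reading `StepX.LogvolCoarse`
  (REAL content, not provable outright): admissibility and log-volume of `S.D P.n` are invariant under
  the WHOLE group `Cor312.Setting.indGroup S = ⟨Ind1Family ∪ Ind2Family⟩`, and the log-volume is
  monotone on admissible regions (the only thing (Ind3)'s containments can then yield is an upper
  bound — no equality survives, which is the printed "inequality [from above]"). KERNEL LEMMAS:
  `logvolCoarse_of_generators` (generator-level invariance ⇒ the group, via the landed closure induction
  `MRData.adm_and_logvol_eq_of_mem_closure`, L6-t13), `LogvolCoarse.adm_and_logvol_eq_of_mem_possibleImages`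
  (the "coarse space" on the possible images: every possible image of the Θ-pilot is admissible with THE
  SAME log-volume as the (Ind3)-union), `LogvolCoarse.unitImage_logvol_le_shellPk` ((Ind3)'s printed
  containments, `Thm311.Column.Ind3`, converted into the volume inequality from above).
* `Obs.logvolLogLinkCompatible` — "the log-link compatibility of the various log-volumes … ensures that
  these log-volumes are compatible with … the various arrows … of the log-Kummer correspondence"
  (p. 181 l. 13–18). Reading `StepX.LogvolLogLink` := c312-1's `Column.LogvolPrecise` (the final clause
  of Thm 3.11 (ii), the locus `thm3_11_ii_logvol` this step cites); KERNEL LEMMA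
  `logvolLogLink_of_kummerA` = the landed `Column.logvolPrecise_of_kummerA` ((ii) (a)'s log-volume
  compatibility supplies it at every `m`).
* `Obs.tensorIdentifiesMultZ` — "the various tensor products that appear in the various local
  mono-analytic tensor packets … have the effect of identifying the operation of "multiplication by
  elements of `ℤ`" — and hence also the effect on log-volumes of such multiplication operations! — at
  different labels `∈ F^⋇_l`" (p. 181 l. 26–32). Reading `StepX.TensorMultZ`, PROVED outright
  (`tensorMultZ_holds`) from genuine multilinear algebra: on a tensor packet
  `⨂[ℚ] i ∈ S^±_{j+1}, log(𝒟^⊢_{v_ℚ})` the operator "multiply the `i₀`-th tensor factor by `n ∈ ℤ`"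
  (`mulThroughFactor`, `Thm311.LogShells.mulZ`) EQUALS scalar multiplication by `n` on the whole packet
  (`mulThroughFactor_eq_smul_id`), hence is the same operator for every factor label and has the same
  effect on every region and its log-volume (`mulZ_image`).

`Cor312Proof.stepX_holds` then proves `Step.x.Holds L O` for ANY reading `(L, O)` wired to these
contents (pointwise hypotheses, the c312-6 convention), and `Cor312Proof.OStepX`/`stepX_holds_OStepX`
package the four readings as an overlay `Obs → Prop` over any base reading — the A-1 deliverable shape.
The loci-side hypotheses (`L .Ind1`/`L .Ind2`/`L .prop3_9_ii` supply generator invariance and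
monotonicity; `L .thm3_11_ii_a` supplies `Column.KummerA`) are exactly what TEAM B's rows B-2/B-4 land
for the real instances (`Thm311.Real.situation`); this file consumes them as named hypotheses and never
re-proves them (C312-TEAMS B.2 division).

Sources read on the page (this seat's renders, `folder/.lit/texts/`): [IUTchIII] pp. 180–181 (Step (x)),
p. 154–156 (Thm 3.11 (i), (ii)). [claim: Mochizuki2012, status: disputed] Deliberately NOT here: the
real-instance discharges of the loci hypotheses (TEAM B); Steps (xi-a)–(xi-g) (rows A-2/A-3/A-4); the
(xi-f) edge and GapA (A-4); any judgement.
-/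

noncomputable section

open Set
open scoped Pointwise TensorProduct

namespace Summit.ABC

namespace IUTFork

/-! ## 1. Multiplication by a scalar through one tensor factor (pure multilinear algebra) -/

section MulThroughFactor

variable {R : Type*} [CommSemiring R] {ι : Type*} [DecidableEq ι]
  {M : ι → Type*} [∀ i, AddCommGroup (M i)] [∀ i, Module R (M i)]

/-- The operator on `⨂[R] i, M i` that multiplies the `i₀`-th tensor factor by `c` and leaves every
other factor alone ([IUTchIII] Cor. 3.12 proof, Step (x), p. 181 l. 26–32: ""multiplication by elements
of `ℤ`" … at different labels"; here for any scalar `c` of the base ring). [folklore] -/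
def mulThroughFactor (i₀ : ι) (c : R) : (⨂[R] i, M i) →ₗ[R] ⨂[R] i, M i :=
  PiTensorProduct.map (Function.update (fun _ => LinearMap.id) i₀ (c • LinearMap.id))

/-- **Multiplying ONE tensor factor by `c` is multiplying the WHOLE packet by `c`** — the tensor product
"identifies the operation of multiplication" across the factors: `mulThroughFactor i₀ c = c • id`
(multilinearity of the pure-tensor map in the `i₀`-th slot). [folklore] -/
theorem mulThroughFactor_eq_smul_id (i₀ : ι) (c : R) :
    (mulThroughFactor (M := M) i₀ c) =
      c • (LinearMap.id : (⨂[R] i, M i) →ₗ[R] ⨂[R] i, M i) := by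
  ext m
  have h : (fun i => Function.update (fun x : ι => (LinearMap.id : M x →ₗ[R] M x)) i₀
      (c • LinearMap.id) i (m i)) = Function.update m i₀ (c • m i₀) := by
    funext i
    rcases eq_or_ne i i₀ with rfl | hne
    · simp
    · simp [hne]
  have h2 : (PiTensorProduct.tprod R) (Function.update m i₀ (c • m i₀)) =
      c • (PiTensorProduct.tprod R) m := by
    calc (PiTensorProduct.tprod R) (Function.update m i₀ (c • m i₀))
        = c • (PiTensorProduct.tprod R) (Function.update m i₀ (m i₀)) :=
          MultilinearMap.map_update_smul _ m i₀ c (m i₀)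
      _ = c • (PiTensorProduct.tprod R) m := by rw [Function.update_eq_self]
  simp only [mulThroughFactor, LinearMap.compMultilinearMap_apply, PiTensorProduct.map_tprod,
    LinearMap.smul_apply, LinearMap.id_apply]
  exact (congrArg (PiTensorProduct.tprod R) h).trans h2

/-- Hence the operator does not depend on WHICH factor the multiplication is performed in. [folklore] -/
theorem mulThroughFactor_factor_irrelevant (i₀ i₁ : ι) (c : R) :
    (mulThroughFactor (M := M) i₀ c) = mulThroughFactor i₁ c := by
  rw [mulThroughFactor_eq_smul_id, mulThroughFactor_eq_smul_id]

end MulThroughFactor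

/-! ## 2. The packet-level form: `mulZ` on the tensor packets of the multiradial representation -/

namespace Thm311

namespace LogShells

variable {T : ThetaIndex} (L : LogShells T)

/-- "Multiplication by `n ∈ ℤ` performed in the `i₀`-th tensor factor" on the `(j+1)`-tensor packet
`log(^{S^±_{j+1}}𝒟^⊢_{v_ℚ})` of the multiradial representation ([IUTchIII] Cor. 3.12 proof, Step (x),
p. 181 l. 26–32). [claim: Mochizuki2012, status: disputed] -/
def mulZ (j : T.Label) (vQ : T.VQ) (i₀ : T.Caps j) (n : ℤ) :
    L.Packet j vQ →ₗ[ℚ] L.Packet j vQ :=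
  mulThroughFactor i₀ (n : ℚ)

/-- On the packet, multiplication by `n` through any one factor IS scalar multiplication by `n` on the
whole packet. [folklore] -/
theorem mulZ_eq_smul_id (j : T.Label) (vQ : T.VQ) (i₀ : T.Caps j) (n : ℤ) :
    L.mulZ j vQ i₀ n = (n : ℚ) • (LinearMap.id : L.Packet j vQ →ₗ[ℚ] L.Packet j vQ) :=
  mulThroughFactor_eq_smul_id i₀ (n : ℚ)

/-- **The factor label is irrelevant**: `mulZ` at `i₀` equals `mulZ` at `i₁` — the printed
"identifying the operation of "multiplication by elements of `ℤ`" … at different labels". [folklore] -/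
theorem mulZ_factor_irrelevant (j : T.Label) (vQ : T.VQ) (i₀ i₁ : T.Caps j) (n : ℤ) :
    L.mulZ j vQ i₀ n = L.mulZ j vQ i₁ n :=
  mulThroughFactor_factor_irrelevant i₀ i₁ (n : ℚ)

/-- The image of any region under `mulZ` is its `n`-dilate, independently of the factor label — "and
hence also the effect on log-volumes of such multiplication operations" (any log-volume reads the same
set). [folklore] -/
theorem mulZ_image (j : T.Label) (vQ : T.VQ) (i₀ : T.Caps j) (n : ℤ)
    (A : Set (L.Packet j vQ)) : (L.mulZ j vQ i₀ n) '' A = (n : ℚ) • A := by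
  rw [mulZ_eq_smul_id]
  ext x
  simp [Set.mem_smul_set]

end LogShells

end Thm311

/-! ## 3. The real readings of Step (x)'s four observations -/

namespace StepX

open Thm311

variable {T : ThetaIndex} {S : Situation T} (P : Cor312.Setting S)

/-- READING of `Obs.kummerDetachmentInd123` (Step (x), p. 180 l. 43–60) over the frozen verbatim
setting: the Kummer image of the Θ-pilot at every lattice position `(n, m)` enters the multiradial
representation only through the (Ind3)-union `thetaRegion3`, and that union is itself one of the
possible images under the group generated by (Ind1), (Ind2) — "relate the … structures … at `(0,0)` …
to the multiradial representation … at the cost of introducing the indeterminacies". As typed over the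
frozen `Cor312.Setting` this is bookkeeping (`kummerDetach_holds`); the weight of the printed sentence
is in the cited Thm 3.11 (ii), (iii) loci (c312-1 `Column`/`LinkData`), per the team's no-inflation
rule. [claim: Mochizuki2012, status: disputed] -/
@[claim "Mochizuki2012" "disputed"] def KummerDetach : Prop :=
  (∀ (m : ℤ) (j : T.Label) (vQ : T.VQ), P.thetaRegion m j vQ ⊆ P.thetaRegion3 j vQ) ∧
    ∀ (j : T.Label) (vQ : T.VQ), P.thetaRegion3 j vQ ∈ P.possibleImages j vQ

/-- `KummerDetach` holds outright over the frozen setting (union bound + identity indeterminacy).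
[folklore] -/
theorem kummerDetach_holds : KummerDetach P :=
  ⟨fun m _j _vQ => Set.subset_iUnion (fun m' => P.thetaRegion m' _j _vQ) m,
    fun j vQ => P.thetaRegion3_mem_possibleImages j vQ⟩

/-- READING of `Obs.logvolInvariantInequality` (Step (x), p. 181 l. 5–13) — the "coarse space": the
mono-analytic log-volume data of the vertically coric line `S.D P.n` is (a) invariant under the WHOLE
indeterminacy group `⟨Ind1Family ∪ Ind2Family⟩` (= `Cor312.Setting.indGroup S`, the group whose orbit
defines `P.possibleImages`) — "the resulting log-volumes `∈ ℝ` are invariant with respect to the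
indeterminacies (Ind1), (Ind2)" — and (b) monotone under inclusion of admissible regions, so that
(Ind3)'s upper semi-compatibility CONTAINMENTS (`Column.Ind3`) yield volume bounds from above and
nothing stronger — "have the effect of converting the indeterminacy (Ind3) into an inequality [from
above]". REAL content; supplied for the real instances by TEAM B (rows B-2/B-3) and derived from the
generator level by `logvolCoarse_of_generators`. [claim: Mochizuki2012, status: disputed] -/
structure LogvolCoarse : Prop where
  /-- (Ind1)(Ind2)-invariance of admissibility and log-volume, on the whole generated group -/
  ind12 : ∀ Φ ∈ Cor312.Setting.indGroup S, ∀ (j : T.Label) (vQ : T.VQ)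
    (A : Set (S.L.Packet j vQ)), (S.D P.n).Adm j vQ A →
      (S.D P.n).Adm j vQ (Φ j vQ '' A) ∧
        (S.D P.n).logvol j vQ (Φ j vQ '' A) = (S.D P.n).logvol j vQ A
  /-- monotonicity of the log-volume on admissible regions (how a containment becomes an inequality) -/
  mono : ∀ (j : T.Label) (vQ : T.VQ) (A B : Set (S.L.Packet j vQ)), (S.D P.n).Adm j vQ A →
    (S.D P.n).Adm j vQ B → A ⊆ B → (S.D P.n).logvol j vQ A ≤ (S.D P.n).logvol j vQ B

/-- **KERNEL LEMMA (generators ⇒ group).** The (Ind1)(Ind2)-invariance clause of the coarse space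
follows from invariance at the GENERATORS (one (Ind1)-family or (Ind2)-family move — what the cited
loci `Ind1`, `Ind2`, `prop3_9_ii` supply, and what TEAM B lands for the real instances) by the landed
closure induction `MRData.adm_and_logvol_eq_of_mem_closure` (L6-t13, Thm311MultiradProofs). [folklore] -/
theorem logvolCoarse_of_generators
    (hAdm : ∀ Φ ∈ S.L.Ind1Family ∪ S.L.Ind2Family, ∀ (j : T.Label) (vQ : T.VQ)
      (A : Set (S.L.Packet j vQ)), (S.D P.n).Adm j vQ A ↔ (S.D P.n).Adm j vQ (Φ j vQ '' A))
    (hvol : (S.D P.n).LogvolInvariant)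
    (hmono : ∀ (j : T.Label) (vQ : T.VQ) (A B : Set (S.L.Packet j vQ)), (S.D P.n).Adm j vQ A →
      (S.D P.n).Adm j vQ B → A ⊆ B → (S.D P.n).logvol j vQ A ≤ (S.D P.n).logvol j vQ B) :
    LogvolCoarse P :=
  ⟨fun _Φ hΦ j vQ A hA => (S.D P.n).adm_and_logvol_eq_of_mem_closure hAdm hvol hΦ j vQ A hA, hmono⟩

/-- **The "coarse space" on the possible images**: under `LogvolCoarse`, every possible image of the
Θ-pilot object (every element of the `indGroup`-orbit of the (Ind3)-union) is admissible with THE SAME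
log-volume as the (Ind3)-union — the log-volume is well-defined on the multiradial representation up to
(Ind1), (Ind2), which is exactly how Step (x) uses it. [claim: Mochizuki2012, status: disputed] -/
theorem LogvolCoarse.adm_and_logvol_eq_of_mem_possibleImages (h : LogvolCoarse P)
    {j : T.Label} {vQ : T.VQ} (hadm : (S.D P.n).Adm j vQ (P.thetaRegion3 j vQ))
    {U : Set (S.L.Packet j vQ)} (hU : U ∈ P.possibleImages j vQ) :
    (S.D P.n).Adm j vQ U ∧
      (S.D P.n).logvol j vQ U = (S.D P.n).logvol j vQ (P.thetaRegion3 j vQ) := by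
  obtain ⟨Φ, hΦ, rfl⟩ := hU
  exact h.ind12 Φ hΦ j vQ _ hadm

/-- **(Ind3) converted into an inequality from above**: the upper semi-compatibility containments of
Thm 3.11 (ii) as typed by c312-1 (`Column.Ind3`: the unit images of the `m'`-iterated log-links are
CONTAINED in the integral structure `shellPk`) yield, through monotonicity, only the volume bound
`μ^log(unit image) ≤ μ^log(𝓘(−))` — an inequality from above, never an equality (the printed "semi").
[claim: Mochizuki2012, status: disputed] -/
theorem LogvolCoarse.unitImage_logvol_le_shellPk (h : LogvolCoarse P) (C : Column S.L)
    (hInd3 : C.Ind3 (S.D P.n)) {m : ℤ} {m' : ℕ} {j : T.Label} {vQ : T.VQ} (hNon : T.IsNon vQ)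
    (hU : (S.D P.n).Adm j vQ (C.unitImage m m' j vQ))
    (hS : (S.D P.n).Adm j vQ ((S.D P.n).shellPk j vQ)) :
    (S.D P.n).logvol j vQ (C.unitImage m m' j vQ) ≤
      (S.D P.n).logvol j vQ ((S.D P.n).shellPk j vQ) :=
  h.mono j vQ _ _ hU hS (hInd3.1 m m' j vQ hNon)

/-- READING of `Obs.logvolLogLinkCompatible` (Step (x), p. 181 l. 13–18): the log-volume at the lattice
positions `(n, m)` and `(n, m+1)` agree on the admissible regions — c312-1's `Column.LogvolPrecise`,
the typed final clause of Thm 3.11 (ii) (the locus `thm3_11_ii_logvol` this step cites).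
[claim: Mochizuki2012, status: disputed] -/
@[claim "Mochizuki2012" "disputed"] def LogvolLogLink (C : Column S.L) : Prop :=
  C.LogvolPrecise (S.D P.n)

/-- **KERNEL LEMMA**: the log-link compatibility of the log-volumes follows from Thm 3.11 (ii) (a)'s
log-volume compatibility at each `m` separately — the landed `Column.logvolPrecise_of_kummerA`
(both lattice positions read the one coric mono-analytic log-volume). [folklore] -/
theorem logvolLogLink_of_kummerA (C : Column S.L) (h : C.KummerA (S.D P.n)) :
    LogvolLogLink P C :=
  C.logvolPrecise_of_kummerA (S.D P.n) h

/-- READING of `Obs.tensorIdentifiesMultZ` (Step (x), p. 181 l. 26–32): on every tensor packet of the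
multiradial representation, multiplication by `n ∈ ℤ` performed through the `i₀`-th factor equals
multiplication through the `i₁`-th factor — both are the `n`-dilation of the packet — and consequently
the two operations have the same effect on every region and hence on its log-volume.
[claim: Mochizuki2012, status: disputed] -/
@[claim "Mochizuki2012" "disputed"] def TensorMultZ : Prop :=
  ∀ (j : T.Label) (vQ : T.VQ) (i₀ i₁ : T.Caps j) (n : ℤ) (A : Set (S.L.Packet j vQ)),
    (S.L.mulZ j vQ i₀ n) '' A = (S.L.mulZ j vQ i₁ n) '' A ∧
      (S.D P.n).logvol j vQ ((S.L.mulZ j vQ i₀ n) '' A) = (S.D P.n).logvol j vQ ((n : ℚ) • A)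

/-- `TensorMultZ` holds outright — genuine multilinear algebra over the frozen packets
(`mulThroughFactor_eq_smul_id`): the identification claimed by the printed sentence is a theorem of
the `ℚ`-tensor-product construction itself. [folklore] -/
theorem tensorMultZ_holds : TensorMultZ P := by
  intro j vQ i₀ i₁ n A
  constructor
  · rw [S.L.mulZ_factor_irrelevant j vQ i₀ i₁ n]
  · rw [S.L.mulZ_image j vQ i₀ n A]

end StepX

/-! ## 4. Step (x) as an inference: `Step.Holds` wired to the real readings -/

namespace Cor312Proof

open StepX Thm311

variable {T : ThetaIndex} {S : Situation T} (P : Cor312.Setting S)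

/-- **Step (x) HOLDS** under any reading `(L, O)` wired to the real contents: if the cited loci supply
the generator-level (Ind1)(Ind2) invariances and the monotonicity of the log-volume (`L .Ind1`,
`L .Ind2`, `L .prop3_9_ii` — TEAM B's discharges for the real instances) and Thm 3.11 (ii) (a)'s
log-volume compatibility (`L .thm3_11_ii_a`), and if `O` grants each of (x)'s four observations on its
real reading, then the node (p. 180 l. 43 – p. 181 l. 32) is a valid inference. The six observations
(x) invokes from Steps (i)–(ix) are not needed for these four conclusions as read — the step is the
proof's own summary of the cited loci. [claim: Mochizuki2012, status: disputed] -/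
theorem stepX_holds (C : Column S.L) {L : Locus → Prop} {O : Obs → Prop}
    (hIndAdm : L .Ind1 → L .Ind2 → ∀ Φ ∈ S.L.Ind1Family ∪ S.L.Ind2Family,
      ∀ (j : T.Label) (vQ : T.VQ) (A : Set (S.L.Packet j vQ)),
        (S.D P.n).Adm j vQ A ↔ (S.D P.n).Adm j vQ (Φ j vQ '' A))
    (hIndVol : L .Ind1 → L .Ind2 → L .prop3_9_ii → (S.D P.n).LogvolInvariant)
    (hMono : L .prop3_9_ii → ∀ (j : T.Label) (vQ : T.VQ) (A B : Set (S.L.Packet j vQ)),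
      (S.D P.n).Adm j vQ A → (S.D P.n).Adm j vQ B → A ⊆ B →
        (S.D P.n).logvol j vQ A ≤ (S.D P.n).logvol j vQ B)
    (hKumA : L .thm3_11_ii_a → C.KummerA (S.D P.n))
    (hO1 : KummerDetach P → O .kummerDetachmentInd123)
    (hO2 : LogvolCoarse P → O .logvolInvariantInequality)
    (hO3 : LogvolLogLink P C → O .logvolLogLinkCompatible)
    (hO4 : TensorMultZ P → O .tensorIdentifiesMultZ) :
    Step.x.Holds L O := by
  intro hc _hu o ho
  have hL1 : L .Ind1 := hc _ (by decide)
  have hL2 : L .Ind2 := hc _ (by decide)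
  have hL39 : L .prop3_9_ii := hc _ (by decide)
  have hLa : L .thm3_11_ii_a := hc _ (by decide)
  have hobs : o = .kummerDetachmentInd123 ∨ o = .logvolInvariantInequality ∨
      o = .logvolLogLinkCompatible ∨ o = .tensorIdentifiesMultZ := by
    simpa [Step.concl, Step.data] using ho
  rcases hobs with rfl | rfl | rfl | rfl
  · exact hO1 (kummerDetach_holds P)
  · exact hO2 (logvolCoarse_of_generators P (hIndAdm hL1 hL2) (hIndVol hL1 hL2 hL39) (hMono hL39))
  · exact hO3 (logvolLogLink_of_kummerA P C (hKumA hLa))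
  · exact hO4 (tensorMultZ_holds P)

/-- The A-1 deliverable shape: the OVERLAY reading assigning to Step (x)'s four observations their real
contents over `(P, C)` and deferring every other observation to a base reading (the other rows' files).
[claim: Mochizuki2012, status: disputed] -/
def OStepX (C : Column S.L) (base : Obs → Prop) : Obs → Prop := fun o =>
  match o with
  | .kummerDetachmentInd123 => StepX.KummerDetach P
  | .logvolInvariantInequality => StepX.LogvolCoarse P
  | .logvolLogLinkCompatible => StepX.LogvolLogLink P C
  | .tensorIdentifiesMultZ => StepX.TensorMultZ P
  | o => base o

/-- `Step.x.Holds` for the overlay reading itself, from the loci-side hypotheses alone. [claim: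
Mochizuki2012, status: disputed] -/
theorem stepX_holds_OStepX (C : Column S.L) {L : Locus → Prop} (base : Obs → Prop)
    (hIndAdm : L .Ind1 → L .Ind2 → ∀ Φ ∈ S.L.Ind1Family ∪ S.L.Ind2Family,
      ∀ (j : T.Label) (vQ : T.VQ) (A : Set (S.L.Packet j vQ)),
        (S.D P.n).Adm j vQ A ↔ (S.D P.n).Adm j vQ (Φ j vQ '' A))
    (hIndVol : L .Ind1 → L .Ind2 → L .prop3_9_ii → (S.D P.n).LogvolInvariant)
    (hMono : L .prop3_9_ii → ∀ (j : T.Label) (vQ : T.VQ) (A B : Set (S.L.Packet j vQ)),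
      (S.D P.n).Adm j vQ A → (S.D P.n).Adm j vQ B → A ⊆ B →
        (S.D P.n).logvol j vQ A ≤ (S.D P.n).logvol j vQ B)
    (hKumA : L .thm3_11_ii_a → C.KummerA (S.D P.n)) :
    Step.x.Holds L (OStepX P C base) :=
  stepX_holds P C hIndAdm hIndVol hMono hKumA
    (fun h => h) (fun h => h) (fun h => h) (fun h => h)

end Cor312Proof

end IUTFork

end Summit.ABC

end
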